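/-
Copyright (c) 2026 the pub-hodgecm-mathlib formalisation cell (harness21).  Prover seat hodgecm-mathlib-LH4-p05 (g8), Track A «(D-RAM) FOUR-FRAME» squad, helper lane on
h413 = stmt-HodgeConjecture-24833 (count-neutral).  Heir dealer∕pen LH4-plan (g13) WORD #58 RULING B (ii) «(β) PRODUCER, statement-first» + WORD #66 (3) ((A″) → LH4-p13 (g8));
this seat's (β) step (2b) letters.  2026-09-04.
-/
import Summits.HodgeConjecture.HodgeConjecture.Theorems.F0P3cDyRamStageOneBDerivedDefs      -- ★ p859675 DEFS LEAF №6 (this seat): (α′) `LabelPlusCleanLawAt`, (β) `CleanSgnFrameConstLawAt`, `mstarOfRecord`, …; brings ★ №5, ★ census DEFS (`LatticeNearTransvShell`, `latticeValueSetMod`, `LatticeLabelPlus`, `transvPlusFixCount`), ★ `valueSetMod`, `xPlus`, ★ #0a `kappaChar`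
import HarnessLib

/-!
# Crux `H413`, line LH4 «(D-RAM) FOUR-FRAME» — DEFS LEAF №7 «CLEAN LABEL»: the clean-shell fixed count with a PRESCRIBED label class, the dichotomy letter (A″)
# `CleanLabelDichotomyLawAt` and the (β) producer target `CleanLabelKappaBalanceLawAt` (κ-balance of the two label classes on the clean shell)

Cell `hodgecm-mathlib` (D-0151), FLOOR 0, crux item H413 = `stmt-HodgeConjecture-24833`, route `HCCMUnconditional`; squad F0∕P3c∕LH4.  DEFINITIONS + `rfl` ties only (lane
`--kind definition --supports stmt-HodgeConjecture-24833 --as helper`); states NO law as a theorem, pays NO row; every `…LawAt` below is a `Prop`-valued PROVER TARGET.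

WHY (this seat 11:40–11:50Z, F0P3-p01 (g35) LABELLED-STRATA v2 40d06553, dealer WORD #66 (3)).  ★ p859891 `F0P3cDyRamCleanSgnKappaForm` makes the ED. 6 letter (β)
`CleanSgnFrameConstLawAt N₀ mc` equivalent to the vanishing of the three κ-censuses of `#T+ − #T−′`.  Two facts about the LABEL turn that into a symmetric statement the Stage-B
strata engines can pay: (α′) ★ `LabelPlusCleanLawAt` (LH4-p13 ★ p859831: a `+`-labelled shell vertex is clean) and (A″) `CleanLabelDichotomyLawAt` (§1: a CLEAN shell vertex is
labelled by SOME unit class `e` — `+` or `−′`, no third class; the «neither» class is the unclean band).  Then `#T+ = cleanLabelFixCount … 1` and `#T−′ = cleanLabelFixCount … u`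
(`u` any `σ`-fixed non-norm unit) and (β) reads `CleanLabelKappaBalanceLawAt`: «the two label classes have the same κ-census on the clean shell» (companion brick
`F0P3cDyRamCleanSgnOfLabelDichotomy`: (α′) ∧ (A″) ∧ balance ⇒ (β)).  DATA: on every (frame, axis stratum) the clean-shell label is PURE (± a frame sign; mirror strata paired) or
EXACTLY half∕half (glued strata) — F0P3-p01 (g35) tables at (7,7,11), (9,9,11), (7,7,13), (9,11,9) ∕ ℚ₂(√2) and (6,6,10), (4,4,8), (8,12,8), (8,10,8) ∕ ℚ₂(i).
* §1 `cleanLabelFixCount σ ϖ d ℓ m mc e T`, `CleanLabelDichotomyLawAt N₀ mc σ ϖ d t` (A″), `CleanLabelKappaBalanceLawAt N₀ mc σ ϖ d t` (β-BAL); ties `cleanLabelFixCount_one`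
  (class `1` = `LatticeLabelPlus`), `cleanLabelFixCount_one_self` (`= transvPlusFixCount` at `mc = m`).
HONEST LABEL.  Count-neutral vocabulary; (A″), (β-BAL), (β) and the tier-0 T₊ row are OPEN; `HC_CM` is proved only modulo the 7 printed citations (2 remaining named inputs:
hLiu418 = `stmt-HodgeConjecture-24832`, h413 = `stmt-HodgeConjecture-24833`) until rung 0 closes.

## References
* [Rogawski1990] J. D. Rogawski, *Automorphic Representations of Unitary Groups in Three Variables*, Ann. of Math. Stud. 123 (1990): §4.9 Prop. 4.9.1 (a)(b) p. 55.
* [Kottwitz1986BaseChangeUnits] R. E. Kottwitz, *Base change for unit elements of Hecke algebras*, Compositio Math. 60 (1986), §1 pp. 240–241.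
* [LanglandsShelstad1987] R. P. Langlands, D. Shelstad, *On the definition of transfer factors*, Math. Ann. 278 (1987), §1.3, §3.
* [Serre1979] J.-P. Serre, *Local Fields*, GTM 67 (1979), Ch. V §3 Cor. 3 (norm classes of units).
-/

set_option autoImplicit false

noncomputable section

namespace Summit.HodgeConjecture.HodgeConjecture.Cruxes.H413.F0P3cDyRamCleanLabelDefs

open scoped Matrix MatrixGroups WithZero
open Literature.NumberTheory.Automorphic Literature.NumberTheory.Automorphic.HermitianLattice
open Literature.NumberTheory.Automorphic.UnitaryLatticeTree Literature.NumberTheory.Automorphic.UnitaryThreeFourFrame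
open Summit.HodgeConjecture.HodgeConjecture.Cruxes.H413.F0P3cDyRamFourFramePieces
open Summit.HodgeConjecture.HodgeConjecture.Cruxes.H413.F0P3cDyRamFourFrameCensusDefs
open Summit.HodgeConjecture.HodgeConjecture.Cruxes.H413.F0P3cDyRamStageOneBDefs
open Summit.HodgeConjecture.HodgeConjecture.Cruxes.H413.F0P3cDyRamStageOneBDerivedDefs

/-! ## §1  (β) PRODUCER LETTERS (2026-09-04, WORD #58 RULING B (ii) step (2b); this seat 11:43∕11:46∕11:50Z, F0P3-p01 (g35) LABELLED-STRATA v2 40d06553): the clean-shell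
count with a PRESCRIBED LABEL CLASS, the dichotomy (A″) «clean ⇒ labelled by some unit class», and the producer target «κ-balance of the two classes on the clean shell» -/

/-- **`cleanLabelFixCount σ ϖ d ℓ m mc e T`** — the number of TYPE-0 vertices `M` FIXED by `T` on the CLEAN near-transvection shell `(ℓ, mc)` of `T − 1` whose `ϖ^m`-thickened
hermitian value set is that of the CLASS-`e` reference nilpotent `e • X₊` (`e = 1`: label `+`, = ★ `transvPlusFixCount` read at square level `mc`; `e` a `σ`-fixed NON-norm unit:
the label `−` = `LabelMinus′`; by ★ `valueSetMod_smul_xPlus_mul_norm` the set depends on `e` only modulo norms of units).  The currency of (A″) and of the (β) balance below.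
[cite: Rogawski1990, §4.9 Prop. 4.9.1 (b) p. 55] [cite: Kottwitz1986BaseChangeUnits, §1 pp. 240–241] -/
def cleanLabelFixCount {K : Type} [Field K] [Valued K ℤᵐ⁰] (σ : K →+* K) (ϖ : K) (d ℓ m mc : ℕ) (e : K) (T : GL (Fin 3) K) : ℕ :=
  {M : Submodule (Valued.integer K) (Fin 3 → K) | IsVertexLattice σ ϖ ((StdForm.antidiagonal 3).over K) 0 M ∧ mapGL T M = M ∧
      LatticeNearTransvShell ϖ ℓ mc ((T : Matrix (Fin 3) (Fin 3) K) - 1) M ∧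
      latticeValueSetMod σ ϖ m M ((T : Matrix (Fin 3) (Fin 3) K) - 1) = valueSetMod σ ϖ m (e • xPlus σ ϖ d)}.ncard

/-- (A″)-At · **«ON THE CLEAN SHELL EVERY VERTEX IS LABELLED BY SOME UNIT CLASS»** (`CleanLabelDichotomyLawAt N₀ mc σ ϖ d t`): at one datum, on a type-(1) four-frame family
at an element datum above `N₀ d`, every `Γ_b`-fixed type-0 vertex `M` on the CLEAN shell `(ℓ₀, mc d)` of `Γ_b − 1` has the `ϖ^{m*}`-thickened value set of `e • X₊` for SOME
`σ`-fixed unit `e` (so, by the index-two dictionary, label `+` or label `−′` — no third class on the clean shell; the «neither» class is the unclean band, F0P3-p01 (g35)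
LABELLED-STRATA v2 (iii); the lattice face of LH4-p13 (g8) ★ (L-lab-6) «clean window ⇒ label = norm class of the skew corner» and LH4-p10 ★ `CleanSignUnipotentVolume` §2–§4).
(α′)'s binder prefix through `hΓ` VERBATIM.  OWNER of the producer: LH4-p13 (g8) ((L-lab) lineage, dealer WORD #66 (3)).  A PROVER TARGET, nothing asserted.
[cite: Rogawski1990, §4.9 Prop. 4.9.1 (b) p. 55] [cite: Serre1979, Ch. V §3 Cor. 3] -/
def CleanLabelDichotomyLawAt {K : Type} [Field K] [Valued K ℤᵐ⁰] [CompleteSpace K] [Fintype (Valued.ResidueField K)] (N₀ mc : ℕ → ℕ) (σ : K →+* K) (ϖ : K) (d t : ℕ) : Prop :=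
    IsRamifiedQuadraticDatum σ ϖ d t →
    ∀ (f : Fin 4 → Fin 3 → (Fin 3 → K)), IsFourFrameFamily σ f →
    ∀ (α β : K) (n₁ n₂ n₃ : ℕ), IsElementDatum σ ϖ (N₀ d) α β n₁ n₂ n₃ →
    ∀ (Γ : Fin 4 → GL (Fin 3) K), (∀ b, (Γ b : Matrix (Fin 3) (Fin 3) K) = frameElt σ f b α β) →
      ∀ (b : Fin 4) (M : Submodule (Valued.integer K) (Fin 3 → K)),
        IsVertexLattice σ ϖ ((StdForm.antidiagonal 3).over K) 0 M → mapGL (Γ b) M = M →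
        LatticeNearTransvShell ϖ (d % 2) (mc d) ((Γ b : Matrix (Fin 3) (Fin 3) K) - 1) M →
          ∃ e : K, σ e = e ∧ Valued.v e = 1 ∧
            latticeValueSetMod σ ϖ (mstarOfRecord d) M ((Γ b : Matrix (Fin 3) (Fin 3) K) - 1) = valueSetMod σ ϖ (mstarOfRecord d) (e • xPlus σ ϖ d)

/-- (β-BAL)-At · **THE PRODUCER TARGET OF (β): «ON THE CLEAN SHELL THE TWO LABEL CLASSES HAVE THE SAME κ-CENSUS»** (`CleanLabelKappaBalanceLawAt N₀ mc σ ϖ d t`): for every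
`σ`-fixed NON-NORM unit `u` and each `i : Fin 3`, `Σ_b κ_i(b)·cleanLabelFixCount (ℓ₀, m*, mc d) 1 (Γ_b) = Σ_b κ_i(b)·cleanLabelFixCount (ℓ₀, m*, mc d) u (Γ_b)` — amplitude ZERO in the
currency of ★ `TransvPlusKappaSignLawAtS2`; with (α′) `LabelPlusCleanLawAt` and (A″) `CleanLabelDichotomyLawAt` it IS (β) (companion brick `F0P3cDyRamCleanSgnOfLabelDichotomy` over ★
`F0P3cDyRamCleanSgnKappaForm`).  DATA (F0P3-p01 (g35) LABELLED-STRATA v2): on every (frame, axis stratum) the clean-shell label is PURE ± a frame sign (dominated strata, mirror-paired)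
or EXACTLY half∕half (glued strata) — the mechanism the Stage-B strata engines (LH4-p09∕p12, F0P3a-p01) are to pay.  A PROVER TARGET, nothing asserted.
[cite: Rogawski1990, §4.9 Prop. 4.9.1 (a)(b) p. 55] [cite: LanglandsShelstad1987, §1.3, §3] -/
def CleanLabelKappaBalanceLawAt {K : Type} [Field K] [Valued K ℤᵐ⁰] [CompleteSpace K] [Fintype (Valued.ResidueField K)] (N₀ mc : ℕ → ℕ) (σ : K →+* K) (ϖ : K) (d t : ℕ) : Prop :=
    IsRamifiedQuadraticDatum σ ϖ d t →
    ∀ (f : Fin 4 → Fin 3 → (Fin 3 → K)), IsFourFrameFamily σ f →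
    ∀ (α β : K) (n₁ n₂ n₃ : ℕ), IsElementDatum σ ϖ (N₀ d) α β n₁ n₂ n₃ →
    ∀ (Γ : Fin 4 → GL (Fin 3) K), (∀ b, (Γ b : Matrix (Fin 3) (Fin 3) K) = frameElt σ f b α β) →
      ∀ (u : K), σ u = u → Valued.v u = 1 → (¬ ∃ z : K, z * σ z = u) →
      ∀ i : Fin 3,
        (∑ b : Fin 4, kappaChar i b * (cleanLabelFixCount σ ϖ d (d % 2) (mstarOfRecord d) (mc d) 1 (Γ b) : ℤ)) =
          ∑ b : Fin 4, kappaChar i b * (cleanLabelFixCount σ ϖ d (d % 2) (mstarOfRecord d) (mc d) u (Γ b) : ℤ)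

/-- Tie · at `e = 1` the class-`e` clean count is the `+`-labelled clean count: `1 • X₊ = X₊` and `LatticeLabelPlus` unfolds to the value-set equation (`Iff.rfl` per vertex).
[cite: Rogawski1990, §4.9 Prop. 4.9.1 (b) p. 55] -/
theorem cleanLabelFixCount_one {K : Type} [Field K] [Valued K ℤᵐ⁰] (σ : K →+* K) (ϖ : K) (d ℓ m mc : ℕ) (T : GL (Fin 3) K) :
    cleanLabelFixCount σ ϖ d ℓ m mc 1 T =
      {M : Submodule (Valued.integer K) (Fin 3 → K) | IsVertexLattice σ ϖ ((StdForm.antidiagonal 3).over K) 0 M ∧ mapGL T M = M ∧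
          LatticeNearTransvShell ϖ ℓ mc ((T : Matrix (Fin 3) (Fin 3) K) - 1) M ∧ LatticeLabelPlus σ ϖ d m M ((T : Matrix (Fin 3) (Fin 3) K) - 1)}.ncard := by
  rw [cleanLabelFixCount, one_smul]
  rfl

/-- Tie · at `mc = m` the class-`1` clean count IS ★ `transvPlusFixCount` (same shell, same label). [cite: Rogawski1990, §4.9 Prop. 4.9.1 (b) p. 55] -/
theorem cleanLabelFixCount_one_self {K : Type} [Field K] [Valued K ℤᵐ⁰] (σ : K →+* K) (ϖ : K) (d ℓ m : ℕ) (T : GL (Fin 3) K) :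
    cleanLabelFixCount σ ϖ d ℓ m m 1 T = transvPlusFixCount σ ϖ d ℓ m T := by
  rw [cleanLabelFixCount_one]
  rfl

end Summit.HodgeConjecture.HodgeConjecture.Cruxes.H413.F0P3cDyRamCleanLabelDefs

end
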